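import Summits.CriticalPhenomena.CardyFormulaZ2.Theorems.CardyIKTransportIKMixedBoxCrossingDefectStubRowTwist

/-!
# Helper `condBox_eq_noiseOp` (row-1 tilt representation of conditional box probabilities) for the line
# `defect-closure-exploration` (crux `IKMixedBoxCrossing`, stmt-CriticalPhenomena-5911)

Support file (`--supports stmt-CriticalPhenomena-5911`). Write `ω = (A, B, Pb, Pf, C)` (column / row signs, biased / fair
plaquettes, coins), `μIK` for their product law, `νmix S` for the law of the observables. For a box `U = [a, a + k) × [1, h]`
on the cell row `0`, an event `E` determined by `U` and a colouring `ξ` of the `k` cells of row `0` below it (cylinder `C_ξ`):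
`2 ^ k · νmix S (E ∩ C_ξ) = ∑_ε (∏_i w_i(ε_i)) · H (incr ξ ⊕ ε)`, `H ∈ [0, 1]`, `incr ξ = (ξ_i ⊕ ξ_{i+1})_i`, `w_i(1) = p_i`,
`w_i(0) = 1 - p_i`, `p_i = 2√3 − 3` on `S`-columns and `½` elsewhere. PROOF (elementary, no conditional measures): a cell
`v = (a + i, j)`, `j ≥ 1`, is black iff `A (a+i) ⊕ B j ⊕ RZ (a+i) ⊕ UP v`, with `RZ x` the parity of the plaquettes of the
anchored face row `[min 0 x, max 0 x) × {0}` and `UP v` that of the anchored rectangle of `v` minus its bottom row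
(`odd_filter_rect_split`); `(x, 0)` is black iff `A x ⊕ B 0`. Partition according to `β = B 0` and `ρ = (RZ (a+i))_i`: on the
piece `(β, ρ)` and on `C_ξ`, `A (a+i) = ξ_i ⊕ β`, so on `U` the colours are those of the SYNTHETIC configuration
`cfg u : v ↦ u_i ⊕ B j ⊕ UP v`, `u = ξ ⊕ β ⊕ ρ`, and `E ∋ obs` iff `E ∋ cfg u`. The events {`A = ξ ⊕ β` on the columns},
{`B 0 = β`}, {`RZ = ρ`}, {`cfg u ∈ E`} read DISJOINT coordinates (`A`; `B 0`; row-`0` plaquettes; `B` off `0`, upper plaquettes,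
coins), hence factor (`RowTwistStub.indepFun_proj`), with masses `2^{-k}`, `½` (`sitePercolation_real_cylinder`). Summing
over `β` averages `g u = μ(cfg u ∈ E)` over the global flip, a function `H` of `incr u = incr ξ ⊕ incr ρ` (`eq_of_incr_eq`);
summing over the `ρ` of increments `ε` gives the face cylinder {face `(a+i, 0)` odd iff `ε_i`} (`odd_filter_Ico_succ`).
-/
noncomputable section

namespace Summit.CriticalPhenomena.CardyFormulaZ2.Cruxes.IKMixedBoxCrossing.DefectClosureExploration

open scoped Classical BigOperators
open MeasureTheory ProbabilityTheory Set Finset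
open Literature.Probability.Percolation Literature.Probability.LatticeModels
open Summit.CriticalPhenomena.CardyFormulaZ2.Theorems.IKLinearTransport.PinnedDiagramExchange (Ω μIK blackSet parSet
  antiSet Obs obs νmix determinedOn measurable_obs' isProbabilityMeasure_nuMix sum_Ico_minmax_chasles)
open Summit.CriticalPhenomena.CardyFormulaZ2.Theorems.IKLinearTransport.PinnedDiagramExchange.CouplingToLimits
  (measurable_xor measurable_mem_parSet measurable_mem_antiSet measurable_card_filter isProbabilityMeasure_μIK)
open Summit.CriticalPhenomena.CardyFormulaZ2.Cruxes.IKMixedBoxCrossing.XorRectangleFlip.IncrStub (mem_parSet_congr)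

namespace CondBoxStub

/-! ## §1 Generic tools: Bernoulli cylinders, independence of disjoint coordinates, parities -/

/-- Cylinder probabilities of a Bernoulli site field: prescribing the states of finitely many distinct sites. -/
theorem sitePercolation_real_cylinder {V ι : Type*} [Fintype ι] (p : unitInterval) {e : ι → V}
    (he : Function.Injective e) (η : ι → Bool) :
    (sitePercolation V p).real {T | ∀ i, (e i ∈ T ↔ η i = true)} = ∏ i, (if η i then (p : ℝ) else 1 - p) := by
  have hpre : (fun χ : V → Prop => {v | χ v}) ⁻¹' {T : Set V | ∀ i, (e i ∈ T ↔ η i = true)} =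
      Set.pi (↑(Finset.univ.map ⟨e, he⟩)) (fun v => {q | q ↔ ∃ i, e i = v ∧ η i = true}) := by
    ext χ
    simp only [Set.mem_preimage, Set.mem_setOf_eq, Set.mem_pi, Finset.coe_map, Finset.coe_univ, Set.image_univ,
      Set.mem_range, forall_exists_index, forall_apply_eq_imp_iff, he.eq_iff, exists_eq_left, Function.Embedding.coeFn_mk]
  rw [measureReal_def, sitePercolation_apply', hpre, sitePi, Measure.infinitePi_pi, Finset.prod_map, ENNReal.toReal_prod]
  · refine Finset.prod_congr rfl fun i _ => ?_
    have h1 : {q : Prop | q ↔ ∃ i', e i' = e i ∧ η i' = true} = {q | q ↔ η i = true} := by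
      ext q; simp only [Set.mem_setOf_eq, he.eq_iff, exists_eq_left]
    rw [Function.Embedding.coeFn_mk, h1, ← measureReal_def]
    cases η i
    · rw [show {q : Prop | q ↔ false = true} = {False} from Set.ext fun q => by simp, bernoulliProp_real_false]; simp
    · rw [show {q : Prop | q ↔ true = true} = {True} from Set.ext fun q => by simp, bernoulliProp_real_true]; simp
  · exact fun _ _ => MeasurableSpace.measurableSet_top

/-- Events reading DISJOINT coordinate sets of the five gauge fields are independent under `μIK`. -/
theorem real_inter_eq_mul {A₁ A₂ B₁ B₂ : Set ℤ} {P₁ P₂ Q₁ Q₂ C₁ C₂ : Set (Site 2)} (dA : Disjoint A₁ A₂)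
    (dB : Disjoint B₁ B₂) (dP : Disjoint P₁ P₂) (dQ : Disjoint Q₁ Q₂) (dC : Disjoint C₁ C₂) {X Y : Set Ω}
    (hX : MeasurableSet X) (hY : MeasurableSet Y)
    (hX' : ∀ ω : Ω, ((ω.1 ∩ A₁, (ω.2.1 ∩ B₁, (ω.2.2.1 ∩ P₁, (ω.2.2.2.1 ∩ Q₁, ω.2.2.2.2 ∩ C₁)))) : Ω) ∈ X ↔ ω ∈ X)
    (hY' : ∀ ω : Ω, ((ω.1 ∩ A₂, (ω.2.1 ∩ B₂, (ω.2.2.1 ∩ P₂, (ω.2.2.2.1 ∩ Q₂, ω.2.2.2.2 ∩ C₂)))) : Ω) ∈ Y ↔ ω ∈ Y) :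
    μIK.real (X ∩ Y) = μIK.real X * μIK.real Y := by
  have h := (RowTwistStub.indepFun_proj dA dB dP dQ dC).measure_inter_preimage_eq_mul _ _ hX hY
  rw [show (fun ω : Ω => ((ω.1 ∩ A₁, (ω.2.1 ∩ B₁, (ω.2.2.1 ∩ P₁, (ω.2.2.2.1 ∩ Q₁, ω.2.2.2.2 ∩ C₁)))) : Ω)) ⁻¹' X = X
    from Set.ext hX', show (fun ω : Ω => ((ω.1 ∩ A₂, (ω.2.1 ∩ B₂, (ω.2.2.1 ∩ P₂, (ω.2.2.2.1 ∩ Q₂, ω.2.2.2.2 ∩ C₂)))) : Ω))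
      ⁻¹' Y = Y from Set.ext hY'] at h
  simp only [measureReal_def, h, ENNReal.toReal_mul]

/-- Parity of a filtered finite set as a sum in `ZMod 2`. -/
theorem odd_card_filter_iff {α : Type*} (s : Finset α) (P : α → Prop) :
    Odd (s.filter P).card ↔ (∑ x ∈ s, if P x then (1 : ZMod 2) else 0) = 1 := by
  rw [← ZMod.natCast_eq_one_iff_odd, Finset.natCast_card_filter]

/-- TELESCOPING of the anchored parities: moving the endpoint from `x` to `x + 1` toggles by the site `x`. -/
theorem odd_filter_Ico_succ (P : ℤ → Prop) (x : ℤ) : Odd ((Finset.Ico (min 0 (x + 1)) (max 0 (x + 1))).filter P).card ↔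
    Xor (Odd ((Finset.Ico (min 0 x) (max 0 x)).filter P).card) (P x) := by
  rw [odd_card_filter_iff, odd_card_filter_iff, sum_Ico_minmax_chasles _ 0 x (x + 1), min_eq_left (by omega : x ≤ x + 1),
    max_eq_right (by omega : x ≤ x + 1), Finset.Ico_add_one_right_eq_Icc, Finset.Icc_self, Finset.sum_singleton]
  generalize (∑ b ∈ Finset.Ico (min 0 x) (max 0 x), (if P b then (1 : ZMod 2) else 0)) = u
  by_cases hP : P x
  · simp only [hP, if_true]; revert u; decide
  · simp only [hP, if_false, add_zero]; revert u; decide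

/-- Splitting the anchored rectangle of an upper cell into its bottom face row and its face rows `≥ 1`. -/
theorem odd_filter_rect_split (P : Site 2 → Prop) (I : Finset ℤ) {j : ℤ} (hj : 1 ≤ j) :
    Odd ((I ×ˢ Finset.Ico (min 0 j) (max 0 j)).filter fun f : ℤ × ℤ => P ![f.1, f.2]).card ↔
      Xor (Odd ((I.filter fun b => P ![b, 0]).card)) (Odd ((I ×ˢ Finset.Ico 1 j).filter fun f : ℤ × ℤ => P ![f.1, f.2]).card) := by
  have h01 : Finset.Ico (0 : ℤ) 1 = {0} := Finset.ext fun b => by simp only [Finset.mem_Ico, Finset.mem_singleton]; omega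
  rw [odd_card_filter_iff, odd_card_filter_iff, odd_card_filter_iff, min_eq_left (by omega : (0 : ℤ) ≤ j),
    max_eq_right (by omega : (0 : ℤ) ≤ j), ← Finset.Ico_union_Ico_eq_Ico (show (0 : ℤ) ≤ 1 by omega) hj, Finset.product_union,
    Finset.sum_union (Finset.disjoint_product.2 (Or.inr (Finset.Ico_disjoint_Ico_consecutive 0 1 j))), Finset.sum_product, h01]
  simp only [Finset.sum_singleton]
  generalize (∑ b ∈ I, (if P ![b, 0] then (1 : ZMod 2) else 0)) = u
  generalize (∑ x ∈ I ×ˢ Finset.Ico 1 j, (if P ![x.1, x.2] then (1 : ZMod 2) else 0)) = v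
  revert u v; decide

/-- Congruence for exclusive or. -/
theorem xor_congr' {a b c d : Prop} (h₁ : a ↔ c) (h₂ : b ↔ d) : (Xor a b ↔ Xor c d) := by rw [h₁, h₂]

/-- `decide` against a Boolean. -/
theorem decide_eq_bool_iff (P : Prop) [Decidable P] (b : Bool) : (decide P = b) ↔ (P ↔ b = true) := by cases b <;> simp

/-- Exclusive or of two propositions tracked by Booleans. -/
theorem xor_iff_of_iff {P Q : Prop} {p q : Bool} (hp : P ↔ p = true) (hq : Q ↔ q = true) : (Xor P Q ↔ xor p q = true) := by
  cases p <;> cases q <;> simp_all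

/-- Solving `P ⊕ Q = x` for `P`. -/
theorem iff_of_xor_iff {P Q : Prop} {x q : Bool} (h : Xor P Q ↔ x = true) (hq : Q ↔ q = true) : (P ↔ xor x q = true) := by
  cases x <;> cases q <;> simp_all [Xor]

/-- A Boolean vector on `Fin (k + 1)` is determined by its first entry and its successive increments. -/
theorem eq_of_incr_eq {k : ℕ} {u u' : Fin (k + 1) → Bool} (h0 : u 0 = u' 0)
    (h : ∀ i : Fin k, xor (u i.castSucc) (u i.succ) = xor (u' i.castSucc) (u' i.succ)) : u = u' := by
  funext i
  induction i using Fin.induction with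
  | zero => exact h0
  | succ i ih => have hi := h i; rw [ih] at hi; revert hi; cases u' i.castSucc <;> cases u i.succ <;> cases u' i.succ <;> simp

/-! ## §2 The computation for a box of `k + 1` columns -/

/-- The tilt representation for boxes with `k + 1 ≥ 1` columns (increments indexed by `Fin k`). -/
theorem main (S : Set ℤ) (a : ℤ) (k h : ℕ) (E : Set Obs) (hEm : MeasurableSet E)
    (hE : E ∈ determinedOn {v : Site 2 | a ≤ v 0 ∧ v 0 < a + ((k + 1 : ℕ) : ℤ) ∧ 1 ≤ v 1 ∧ v 1 ≤ h}) :
    ∃ H : (Fin k → Bool) → ℝ, (∀ χ, 0 ≤ H χ ∧ H χ ≤ 1) ∧ ∀ ξ : Fin (k + 1) → Bool,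
      (2 : ℝ) ^ (k + 1) * (νmix S).real (E ∩ {x | ∀ i : Fin (k + 1), ((![a + i, 0] : Site 2) ∈ x.1 ↔ ξ i = true)}) =
        ∑ ε : Fin k → Bool, (∏ i : Fin k, if ε i then (if (a + i : ℤ) ∈ S then 2 * Real.sqrt 3 - 3 else 1 / 2)
            else 1 - (if (a + i : ℤ) ∈ S then 2 * Real.sqrt 3 - 3 else 1 / 2)) *
          H (fun i : Fin k => xor (xor (ξ i.castSucc) (ξ i.succ)) (ε i)) := by
  haveI := isProbabilityMeasure_μIK
  -- VOCABULARY: anchored row-`0` parity, upper parity, synthetic configuration and its law, increments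
  set RZ : ℤ → Ω → Prop := fun x ω =>
    Odd (((Finset.Ico (min 0 x) (max 0 x)).filter fun b : ℤ => (![b, 0] : Site 2) ∈ parSet S ω).card) with hRZ
  set UP : Site 2 → Ω → Prop := fun v ω => Odd (((Finset.Ico (min 0 (v 0)) (max 0 (v 0)) ×ˢ Finset.Ico 1 (v 1)).filter
    fun f : ℤ × ℤ => (![f.1, f.2] : Site 2) ∈ parSet S ω).card) with hUP
  set cfg : (Fin (k + 1) → Bool) → Ω → Obs := fun u ω =>
    ({v | ∃ i : Fin (k + 1), v 0 = a + i ∧ 1 ≤ v 1 ∧ Xor (u i = true) (Xor (v 1 ∈ ω.2.1) (UP v ω))}, antiSet S ω) with hcfg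
  set g : (Fin (k + 1) → Bool) → ℝ := fun u => μIK.real (cfg u ⁻¹' E) with hg
  set incr : (Fin (k + 1) → Bool) → (Fin k → Bool) := fun u i => xor (u i.castSucc) (u i.succ) with hincr
  -- EVENTS: column-sign cylinders, the row sign `B 0`, row-`0` parity fibres, face cylinders
  set Acyl : (Fin (k + 1) → Bool) → Set Ω := fun η => {ω | ∀ i : Fin (k + 1), (a + i ∈ ω.1 ↔ η i = true)} with hAcyl
  set B0 : Bool → Set Ω := fun β => {ω | ((0 : ℤ) ∈ ω.2.1 ↔ β = true)} with hB0
  set Rfib : (Fin (k + 1) → Bool) → Set Ω := fun ρ => {ω | ∀ i : Fin (k + 1), (RZ (a + i) ω ↔ ρ i = true)} with hRfib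
  set Efib : (Fin k → Bool) → Set Ω := fun ε =>
    {ω | ∀ i : Fin k, ((![a + i, 0] : Site 2) ∈ parSet S ω ↔ ε i = true)} with hEfib
  -- MEASURABILITY
  have mRZ : ∀ x, Measurable (RZ x) := fun x =>
    (measurable_of_countable fun n : ℕ => Odd n).comp (measurable_card_filter _ fun b => measurable_mem_parSet S _)
  have mUP : ∀ v, Measurable (UP v) := fun v =>
    (measurable_of_countable fun n : ℕ => Odd n).comp (measurable_card_filter _ fun f => measurable_mem_parSet S _)
  have mB : ∀ y : ℤ, Measurable fun ω : Ω => y ∈ ω.2.1 := fun y => (measurable_set_mem y).comp measurable_snd.fst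
  have mcfg : ∀ u, Measurable (cfg u) := fun u =>
    (measurable_set_iff.2 fun v => Measurable.exists fun i => measurable_const.and (measurable_const.and
      (measurable_xor measurable_const (measurable_xor (mB _) (mUP v))))).prodMk (measurable_set_iff.2 (measurable_mem_antiSet S))
  have mAcyl : ∀ η, MeasurableSet (Acyl η) := fun η => measurableSet_setOf.2
    (Measurable.forall fun i => ((measurable_set_mem _).comp measurable_fst).iff measurable_const)
  have mB0 : ∀ β, MeasurableSet (B0 β) := fun β => measurableSet_setOf.2 ((mB 0).iff measurable_const)
  have mRfib : ∀ ρ, MeasurableSet (Rfib ρ) := fun ρ => measurableSet_setOf.2 (Measurable.forall fun i => (mRZ _).iff measurable_const)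
  -- LOCALITY of the parities
  have cRZ : ∀ (x : ℤ) {ω ω' : Ω}, (∀ f : Site 2, f 1 = 0 → (f ∈ parSet S ω' ↔ f ∈ parSet S ω)) → (RZ x ω' ↔ RZ x ω) :=
    fun x ω ω' hP => by simp only [hRZ]; rw [Finset.filter_congr fun b _ => hP (![b, 0]) rfl]
  have cUP : ∀ (v : Site 2) {ω ω' : Ω}, (∀ f : Site 2, 1 ≤ f 1 → (f ∈ parSet S ω' ↔ f ∈ parSet S ω)) → (UP v ω' ↔ UP v ω) :=
    fun v ω ω' hP => by
      simp only [hUP]; rw [Finset.filter_congr fun f hf => hP (![f.1, f.2]) (Finset.mem_Ico.1 (Finset.mem_product.1 hf).2).1]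
  -- THE SYNTHETIC CONFIGURATION agrees with the observables on the box
  have hagree : ∀ (u : Fin (k + 1) → Bool) (ω : Ω),
      (∀ i : Fin (k + 1), (Xor (a + i ∈ ω.1) (RZ (a + i) ω) ↔ u i = true)) → (obs S ω ∈ E ↔ cfg u ω ∈ E) := by
    intro u ω hu
    refine hE (obs S ω) (cfg u ω) fun v hv => ⟨?_, Iff.rfl⟩
    obtain ⟨h0, h1, h2, -⟩ := hv
    obtain ⟨i, hi⟩ : ∃ i : Fin (k + 1), v 0 = a + i :=
      ⟨⟨(v 0 - a).toNat, by omega⟩, by simp only [Int.toNat_of_nonneg (by omega : (0:ℤ) ≤ v 0 - a)]; omega⟩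
    have hsplit := odd_filter_rect_split (fun f : Site 2 => f ∈ parSet S ω) (Finset.Ico (min 0 (v 0)) (max 0 (v 0))) h2
    have hu' := hu i; simp only [hRZ, ← hi] at hu'
    simp only [obs, hcfg, blackSet, Set.mem_setOf_eq, hUP]; rw [hsplit]
    constructor
    · intro hb; exact ⟨i, hi, h2, by revert hb hu'; cases u i <;> grind⟩
    · rintro ⟨i', hi', -, hx⟩; obtain rfl : i' = i := Fin.ext (by omega); revert hx hu'; cases u i' <;> grind
  -- THE PIECES OF THE PARTITION: on `{B 0 = β} ∩ {RZ = ρ}`, `E ∩ C_ξ` is a column cylinder meeting a synthetic event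
  have hfiber : ∀ (ξ : Fin (k + 1) → Bool) (β : Bool) (ρ : Fin (k + 1) → Bool),
      obs S ⁻¹' (E ∩ {x : Obs | ∀ i : Fin (k + 1), ((![a + i, 0] : Site 2) ∈ x.1 ↔ ξ i = true)}) ∩ (B0 β ∩ Rfib ρ) =
        (Acyl (fun i => xor (ξ i) β) ∩ (B0 β ∩ Rfib ρ)) ∩ cfg (fun i => xor (xor (ξ i) β) (ρ i)) ⁻¹' E := by
    intro ξ β ρ; ext ω; simp only [Set.mem_inter_iff, Set.mem_preimage, Set.mem_setOf_eq, hAcyl, hB0, hRfib]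
    constructor
    · rintro ⟨⟨hE', hC⟩, hb, hr⟩
      have hA : ∀ i : Fin (k + 1), (a + i ∈ ω.1 ↔ xor (ξ i) β = true) := fun i =>
        iff_of_xor_iff ((RowTwistStub.mem_blackSet_row0 S ω (a + i)).symm.trans (hC i)) hb
      exact ⟨⟨hA, hb, hr⟩, (hagree _ ω fun i => xor_iff_of_iff (hA i) (hr i)).1 hE'⟩
    · rintro ⟨⟨hA, hb, hr⟩, hcf⟩
      refine ⟨⟨(hagree _ ω fun i => xor_iff_of_iff (hA i) (hr i)).2 hcf, fun i =>
        (RowTwistStub.mem_blackSet_row0 S ω (a + i)).trans ((xor_iff_of_iff (hA i) hb).trans ?_)⟩, hb, hr⟩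
      cases ξ i <;> cases β <;> decide
  -- INDEPENDENCE: the four events read disjoint coordinate sets
  have hind1 : ∀ (η : Fin (k + 1) → Bool) (β : Bool) (ρ u : Fin (k + 1) → Bool),
      μIK.real ((Acyl η ∩ (B0 β ∩ Rfib ρ)) ∩ cfg u ⁻¹' E) = μIK.real (Acyl η ∩ (B0 β ∩ Rfib ρ)) * g u := fun η β ρ u => by
    refine real_inter_eq_mul (A₁ := Set.univ) (A₂ := ∅) (B₁ := {y | y = 0}) (B₂ := {y | 1 ≤ y}) (P₁ := {f | f 1 = 0})
      (P₂ := {f | 1 ≤ f 1}) (Q₁ := {f | f 1 = 0}) (Q₂ := {f | 1 ≤ f 1}) (C₁ := ∅) (C₂ := Set.univ) disjoint_bot_right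
      (Set.disjoint_left.2 fun y (hy : y = 0) (hy' : 1 ≤ y) => by omega)
      (Set.disjoint_left.2 fun f (hf : f 1 = 0) (hf' : 1 ≤ f 1) => by omega)
      (Set.disjoint_left.2 fun f (hf : f 1 = 0) (hf' : 1 ≤ f 1) => by omega) disjoint_bot_left
      ((mAcyl η).inter ((mB0 β).inter (mRfib ρ))) (mcfg u hEm) (fun ω => ?_) (fun ω => ?_)
    · exact and_congr (forall_congr' fun i => iff_congr ⟨fun h => h.1, fun h => ⟨h, Set.mem_univ _⟩⟩ Iff.rfl)
        (and_congr (iff_congr ⟨fun h => h.1, fun h => ⟨h, rfl⟩⟩ Iff.rfl) (forall_congr' fun i => iff_congr (cRZ _ fun f hf =>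
          mem_parSet_congr S ⟨fun h => h.1, fun h => ⟨h, hf⟩⟩ ⟨fun h => h.1, fun h => ⟨h, hf⟩⟩) Iff.rfl))
    · rw [Set.mem_preimage, Set.mem_preimage]; refine Eq.to_iff (congrArg (· ∈ E) ?_); simp only [hcfg]
      refine Prod.ext (Set.ext fun v => exists_congr fun i => and_congr_right fun _ => and_congr_right fun hv => ?_)
        (Set.ext fun f => ?_)
      · exact xor_congr' Iff.rfl (xor_congr' ⟨fun h => h.1, fun h => ⟨h, hv⟩⟩ (cUP v fun f hf =>
          mem_parSet_congr S ⟨fun h => h.1, fun h => ⟨h, hf⟩⟩ ⟨fun h => h.1, fun h => ⟨h, hf⟩⟩))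
      · simp only [antiSet, Set.mem_setOf_eq, Set.inter_univ]
  have hind2 : ∀ (η : Fin (k + 1) → Bool) (β : Bool) (ρ : Fin (k + 1) → Bool),
      μIK.real (Acyl η ∩ (B0 β ∩ Rfib ρ)) = μIK.real (Acyl η) * μIK.real (B0 β ∩ Rfib ρ) := fun η β ρ => by
    refine real_inter_eq_mul (A₁ := Set.univ) (A₂ := ∅) (B₁ := ∅) (B₂ := Set.univ) (P₁ := ∅) (P₂ := Set.univ) (Q₁ := ∅)
      (Q₂ := Set.univ) (C₁ := ∅) (C₂ := ∅) disjoint_bot_right disjoint_bot_left disjoint_bot_left disjoint_bot_left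
      disjoint_bot_left (mAcyl η) ((mB0 β).inter (mRfib ρ)) (fun ω => ?_) (fun ω => ?_)
    · exact forall_congr' fun i => iff_congr ⟨fun h => h.1, fun h => ⟨h, Set.mem_univ _⟩⟩ Iff.rfl
    · exact and_congr (iff_congr ⟨fun h => h.1, fun h => ⟨h, Set.mem_univ _⟩⟩ Iff.rfl) (forall_congr' fun i => iff_congr (cRZ _
        fun f _ => mem_parSet_congr S ⟨fun h => h.1, fun h => ⟨h, Set.mem_univ _⟩⟩ ⟨fun h => h.1, fun h => ⟨h, Set.mem_univ _⟩⟩) Iff.rfl)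
  have hind3 : ∀ (β : Bool) (ρ : Fin (k + 1) → Bool), μIK.real (B0 β ∩ Rfib ρ) = μIK.real (B0 β) * μIK.real (Rfib ρ) :=
      fun β ρ => by
    refine real_inter_eq_mul (A₁ := ∅) (A₂ := ∅) (B₁ := Set.univ) (B₂ := ∅) (P₁ := ∅) (P₂ := Set.univ) (Q₁ := ∅)
      (Q₂ := Set.univ) (C₁ := ∅) (C₂ := ∅) disjoint_bot_right disjoint_bot_right disjoint_bot_left disjoint_bot_left
      disjoint_bot_left (mB0 β) (mRfib ρ) (fun ω => ?_) (fun ω => ?_)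
    · exact iff_congr ⟨fun h => h.1, fun h => ⟨h, Set.mem_univ _⟩⟩ Iff.rfl
    · exact forall_congr' fun i => iff_congr (cRZ _ fun f _ => mem_parSet_congr S
        ⟨fun h => h.1, fun h => ⟨h, Set.mem_univ _⟩⟩ ⟨fun h => h.1, fun h => ⟨h, Set.mem_univ _⟩⟩) Iff.rfl
  -- CYLINDER MASSES: column signs `2^{-(k+1)}`, the row sign `½`, and the face cylinders `∏ w_i(ε_i)`
  have hAval : ∀ η : Fin (k + 1) → Bool, μIK.real (Acyl η) = (1 / 2) ^ (k + 1) := fun η => by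
    have h1 := (by unfold μIK; exact measurePreserving_fst : MeasurePreserving (fun ω : Ω => ω.1) μIK _).measureReal_preimage
      (s := {T : Set ℤ | ∀ i : Fin (k + 1), (a + i ∈ T ↔ η i = true)})
      (measurableSet_setOf.2 (Measurable.forall fun i => (measurable_set_mem _).iff measurable_const)).nullMeasurableSet
    rw [sitePercolation_real_cylinder half (e := fun i : Fin (k + 1) => a + ((i : ℕ) : ℤ))
      (fun i j hij => Fin.ext (by simp only [add_right_inj, Nat.cast_inj] at hij; exact hij)) η] at h1
    rw [show Acyl η = (fun ω : Ω => ω.1) ⁻¹' {T | ∀ i : Fin (k + 1), (a + i ∈ T ↔ η i = true)} from rfl, h1,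
      Finset.prod_congr rfl fun i _ => show (if η i then ((half : unitInterval) : ℝ) else 1 - half) = 1 / 2 by
        cases η i <;> norm_num [half], Finset.prod_const, Finset.card_univ, Fintype.card_fin]
  have hBval : ∀ β : Bool, μIK.real (B0 β) = 1 / 2 := fun β => by
    have h1 := (by unfold μIK; exact measurePreserving_fst.comp measurePreserving_snd :
      MeasurePreserving (fun ω : Ω => ω.2.1) μIK (sitePercolation ℤ half)).measureReal_preimage
      (s := {T : Set ℤ | ∀ _i : Unit, ((0 : ℤ) ∈ T ↔ β = true)})
      (measurableSet_setOf.2 (Measurable.forall fun _ => (measurable_set_mem _).iff measurable_const)).nullMeasurableSet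
    rw [sitePercolation_real_cylinder half (e := fun _ : Unit => (0 : ℤ)) (fun _ _ _ => Subsingleton.elim _ _) (fun _ => β),
      Fintype.prod_unique] at h1
    rw [show B0 β = (fun ω : Ω => ω.2.1) ⁻¹' {T : Set ℤ | ∀ _i : Unit, ((0 : ℤ) ∈ T ↔ β = true)} from
      Set.ext fun ω => (forall_const Unit).symm, h1]
    cases β <;> norm_num [half]
  have hp : ((Set.projIcc (0:ℝ) 1 zero_le_one (2 * Real.sqrt 3 - 3) : unitInterval) : ℝ) = 2 * Real.sqrt 3 - 3 :=
    Summit.CriticalPhenomena.CardyFormulaZ2.Theorems.IKMixedBoxCrossing.Negative.coe_pDef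
  have hEval : ∀ ε : Fin k → Bool, μIK.real (Efib ε) = ∏ i : Fin k, (if ε i then (if (a + i : ℤ) ∈ S then 2 * Real.sqrt 3 - 3
      else 1 / 2) else 1 - (if (a + i : ℤ) ∈ S then 2 * Real.sqrt 3 - 3 else 1 / 2)) := fun ε => by
    -- the faces read `Pb` on `S`-columns and `Pf` elsewhere: two cylinders of two independent fields
    have hsplit : Efib ε = {ω : Ω | ∀ i : Fin k, (a + i : ℤ) ∈ S → ((![a + i, 0] : Site 2) ∈ ω.2.2.1 ↔ ε i = true)} ∩
        {ω : Ω | ∀ i : Fin k, (a + i : ℤ) ∉ S → ((![a + i, 0] : Site 2) ∈ ω.2.2.2.1 ↔ ε i = true)} := by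
      ext ω
      simp only [hEfib, Set.mem_setOf_eq, Set.mem_inter_iff, parSet, Matrix.cons_val_zero]
      constructor
      · exact fun hω => ⟨fun i hs => by simpa [hs] using hω i, fun i hs => by simpa [hs] using hω i⟩
      · rintro ⟨hω, hω'⟩ i
        by_cases hs : (a + i : ℤ) ∈ S; exacts [by simpa [hs] using hω i hs, by simpa [hs] using hω' i hs]
    have hcyl : ∀ (p : Fin k → Prop) [DecidablePred p] (π : Ω → Set (Site 2)) (q : unitInterval),
        MeasurePreserving π μIK (sitePercolation (Site 2) q) → μIK.real {ω | ∀ i : Fin k, p i → ((![a + i, 0] : Site 2) ∈ π ω ↔ ε i = true)} =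
          ∏ j : {i : Fin k // p i}, (if ε j then (q : ℝ) else 1 - q) := fun p _ π q hπ => by
      rw [← sitePercolation_real_cylinder q (e := fun j : {i : Fin k // p i} => (![a + ((j : Fin k) : ℕ), 0] : Site 2))
        (fun j j' hjj' => Subtype.ext (Fin.ext (by simpa using congrFun hjj' 0))) (fun j : {i : Fin k // p i} => ε j),
        ← hπ.measureReal_preimage (measurableSet_setOf.2 (Measurable.forall fun j =>
          (measurable_set_mem _).iff measurable_const)).nullMeasurableSet]
      exact congrArg μIK.real (Set.ext fun ω => by simp only [Set.mem_setOf_eq, Set.mem_preimage, Subtype.forall])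
    have mX : MeasurableSet {ω : Ω | ∀ i : Fin k, (a + i : ℤ) ∈ S → ((![a + i, 0] : Site 2) ∈ ω.2.2.1 ↔ ε i = true)} :=
      measurableSet_setOf.2 (Measurable.forall fun i => measurable_const.imp
        (((measurable_set_mem _).comp measurable_snd.snd.fst).iff measurable_const))
    have mY : MeasurableSet {ω : Ω | ∀ i : Fin k, (a + i : ℤ) ∉ S → ((![a + i, 0] : Site 2) ∈ ω.2.2.2.1 ↔ ε i = true)} :=
      measurableSet_setOf.2 (Measurable.forall fun i => measurable_const.imp
        (((measurable_set_mem _).comp measurable_snd.snd.snd.fst).iff measurable_const))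
    rw [hsplit, real_inter_eq_mul (A₁ := ∅) (A₂ := ∅) (B₁ := ∅) (B₂ := ∅) (P₁ := Set.univ) (P₂ := ∅) (Q₁ := ∅) (Q₂ := Set.univ)
      (C₁ := ∅) (C₂ := ∅) disjoint_bot_left disjoint_bot_left disjoint_bot_right disjoint_bot_left disjoint_bot_left mX mY
      (fun ω => forall_congr' fun i => imp_congr_right fun _ => iff_congr ⟨fun h => h.1, fun h => ⟨h, Set.mem_univ _⟩⟩ Iff.rfl)
      (fun ω => forall_congr' fun i => imp_congr_right fun _ => iff_congr ⟨fun h => h.1, fun h => ⟨h, Set.mem_univ _⟩⟩ Iff.rfl),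
      hcyl (fun i : Fin k => (a + i : ℤ) ∈ S) _ _ (by unfold μIK; exact measurePreserving_fst.comp (measurePreserving_snd.comp
        measurePreserving_snd) : MeasurePreserving (fun ω : Ω => ω.2.2.1) μIK (sitePercolation (Site 2) (Set.projIcc (0:ℝ) 1
          zero_le_one (2 * Real.sqrt 3 - 3)))),
      hcyl (fun i : Fin k => (a + i : ℤ) ∉ S) _ _ (by unfold μIK; exact measurePreserving_fst.comp (measurePreserving_snd.comp
        (measurePreserving_snd.comp measurePreserving_snd)) : MeasurePreserving (fun ω : Ω => ω.2.2.2.1) μIK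
          (sitePercolation (Site 2) half)), ← Fintype.prod_subtype_mul_prod_subtype (fun i : Fin k => (a + i : ℤ) ∈ S)]
    exact congrArg₂ (· * ·) (Fintype.prod_congr _ _ fun j => by simp only [j.2, if_true, hp])
      (Fintype.prod_congr _ _ fun j => by simp only [j.2, if_false]; rfl)
  -- THE FACE CYLINDER with increments `ε` is the union of the parity fibres `ρ` with `incr ρ = ε` (telescoping)
  have hfib2 : ∀ ε : Fin k → Bool, μIK.real (Efib ε) = ∑ ρ ∈ Finset.univ.filter (fun ρ => incr ρ = ε), μIK.real (Rfib ρ) := by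
    intro ε; have hr : ∀ ρ : Fin (k + 1) → Bool, (fun (ω : Ω) (i : Fin (k + 1)) => decide (RZ (a + i) ω)) ⁻¹' {ρ} = Rfib ρ :=
      fun ρ => Set.ext fun ω => by
        simp only [Set.mem_preimage, Set.mem_singleton_iff, funext_iff, hRfib, Set.mem_setOf_eq, decide_eq_bool_iff]
    have hs := sum_measureReal_preimage_singleton (μ := μIK) (Finset.univ.filter fun ρ => incr ρ = ε)
      (f := fun (ω : Ω) (i : Fin (k + 1)) => decide (RZ (a + i) ω)) (fun ρ _ => (hr ρ) ▸ mRfib ρ)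
    simp only [hr] at hs; rw [hs]; refine congrArg μIK.real (Set.ext fun ω => ?_)
    simp only [Set.mem_preimage, Finset.coe_filter, Finset.mem_univ, true_and, Set.mem_setOf_eq, hEfib, funext_iff, hincr]
    refine forall_congr' fun i => ?_
    have hsucc : RZ (a + (((i : ℕ) : ℤ) + 1)) ω ↔ Xor (RZ (a + ((i : ℕ) : ℤ)) ω) ((![a + i, 0] : Site 2) ∈ parSet S ω) := by
      simpa only [hRZ, ← add_assoc] using odd_filter_Ico_succ (fun b => (![b, 0] : Site 2) ∈ parSet S ω) (a + i)
    by_cases hP : RZ (a + ((i : ℕ) : ℤ)) ω <;> by_cases hQ : (![a + i, 0] : Site 2) ∈ parSet S ω <;>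
      cases ε i <;> simp [Fin.val_castSucc, hsucc, hP, hQ]
  -- THE PARTITION according to `(B 0, RZ)`
  have hdec : ∀ X : Set Ω, MeasurableSet X → μIK.real X = ∑ βρ : Bool × (Fin (k + 1) → Bool), μIK.real (X ∩ (B0 βρ.1 ∩ Rfib βρ.2)) := by
    intro X hX; have hV : ∀ βρ : Bool × (Fin (k + 1) → Bool), (fun ω : Ω => (decide ((0 : ℤ) ∈ ω.2.1),
        fun i : Fin (k + 1) => decide (RZ (a + i) ω))) ⁻¹' {βρ} = B0 βρ.1 ∩ Rfib βρ.2 := fun βρ => by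
      obtain ⟨β, ρ⟩ := βρ; ext ω; simp only [Set.mem_preimage, Set.mem_singleton_iff, Prod.mk.injEq, funext_iff, decide_eq_bool_iff, hB0, hRfib,
        Set.mem_inter_iff, Set.mem_setOf_eq]
    have hs := sum_measureReal_preimage_singleton (μ := μIK.restrict X) Finset.univ
      (f := fun ω : Ω => (decide ((0 : ℤ) ∈ ω.2.1), fun i : Fin (k + 1) => decide (RZ (a + i) ω)))
      (fun βρ _ => (hV βρ) ▸ ((mB0 _).inter (mRfib _)))
    rw [Finset.coe_univ, Set.preimage_univ, measureReal_restrict_apply_univ] at hs; rw [← hs]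
    exact Finset.sum_congr rfl fun βρ _ => by rw [measureReal_restrict_apply ((hV βρ) ▸ ((mB0 _).inter (mRfib _))), hV, Set.inter_comm]
  -- THE FIBRE OF `incr` over `incr ξ ⊕ incr ρ` is `{ξ ⊕ β ⊕ ρ | β}`
  have himage : ∀ (ξ ρ : Fin (k + 1) → Bool), Finset.univ.filter (fun u => incr u = fun i => xor (xor (ξ i.castSucc) (ξ i.succ)) (incr ρ i)) =
      Finset.univ.image (fun β : Bool => fun i => xor (xor (ξ i) β) (ρ i)) := by
    intro ξ ρ; ext u; simp only [Finset.mem_filter, Finset.mem_univ, true_and, Finset.mem_image]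
    constructor
    · intro hu
      refine ⟨xor (xor (u 0) (ξ 0)) (ρ 0), eq_of_incr_eq ?_ fun i => ?_⟩
      · show xor (xor (ξ 0) (xor (xor (u 0) (ξ 0)) (ρ 0))) (ρ 0) = u 0
        cases ξ 0 <;> cases u 0 <;> cases ρ 0 <;> rfl
      · have hi := congrFun hu i; simp only [hincr] at hi
        show xor (xor (xor (ξ i.castSucc) (xor (xor (u 0) (ξ 0)) (ρ 0))) (ρ i.castSucc))
          (xor (xor (ξ i.succ) (xor (xor (u 0) (ξ 0)) (ρ 0))) (ρ i.succ)) = xor (u i.castSucc) (u i.succ)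
        rw [hi]; generalize xor (xor (u 0) (ξ 0)) (ρ 0) = β
        cases ξ i.castSucc <;> cases ξ i.succ <;> cases ρ i.castSucc <;> cases ρ i.succ <;> cases β <;> rfl
    · rintro ⟨β, rfl⟩; funext i; simp only [hincr]
      cases ξ i.castSucc <;> cases ξ i.succ <;> cases β <;> cases ρ i.castSucc <;> cases ρ i.succ <;> rfl
  have hinjβ : ∀ (ξ ρ : Fin (k + 1) → Bool), Function.Injective fun β : Bool => fun i => xor (xor (ξ i) β) (ρ i) :=
    fun ξ ρ β β' hββ' => by have h0 := congrFun hββ' 0; revert h0; cases β <;> cases β' <;> cases ξ 0 <;> cases ρ 0 <;> simp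
  -- ASSEMBLY
  refine ⟨fun χ => (∑ u ∈ Finset.univ.filter (fun u => incr u = χ), g u) / 2, fun χ => ⟨?_, ?_⟩, fun ξ => ?_⟩
  · exact div_nonneg (Finset.sum_nonneg fun u _ => measureReal_nonneg) two_pos.le
  · rw [div_le_one (two_pos : (0 : ℝ) < 2)]
    calc ∑ u ∈ Finset.univ.filter (fun u => incr u = χ), g u
        ≤ ∑ u ∈ Finset.univ.filter (fun u => incr u = χ), (1 : ℝ) := Finset.sum_le_sum fun u _ => measureReal_le_one
      _ = ((Finset.univ.filter (fun u => incr u = χ)).card : ℝ) := by simp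
      _ ≤ ((Finset.univ : Finset Bool).card : ℝ) := by
          have hc : (Finset.univ.filter (fun u => incr u = χ)).card ≤ (Finset.univ : Finset Bool).card :=
            Finset.card_le_card_of_injOn (fun u : Fin (k + 1) → Bool => u 0) (fun _ _ => Finset.mem_univ _)
              fun u hu u' hu' h0 => eq_of_incr_eq h0 (funext_iff.1 ((Finset.mem_filter.1 (Finset.mem_coe.1
                hu)).2.trans (Finset.mem_filter.1 (Finset.mem_coe.1 hu')).2.symm))
          exact_mod_cast hc
      _ = 2 := by simp
  · have hmC : MeasurableSet (E ∩ {x : Obs | ∀ i : Fin (k + 1), ((![a + i, 0] : Site 2) ∈ x.1 ↔ ξ i = true)}) :=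
      hEm.inter (measurableSet_setOf.2 (Measurable.forall fun i => ((measurable_set_mem _).comp measurable_fst).iff measurable_const))
    rw [show νmix S = μIK.map (obs S) from rfl, map_measureReal_apply (measurable_obs' S).2.2 hmC,
      hdec _ ((measurable_obs' S).2.2 hmC), Fintype.sum_prod_type]
    simp only [hfiber ξ, hind1, hind2, hind3, hAval, hBval, ← hEval, hfib2, Finset.sum_mul]
    conv_lhs => rw [Finset.sum_comm, Finset.mul_sum]
    refine (Finset.sum_fiberwise Finset.univ incr _).symm.trans (Finset.sum_congr rfl fun ε _ => Finset.sum_congr rfl fun ρ hρ => ?_)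
    obtain rfl : incr ρ = ε := (Finset.mem_filter.1 hρ).2
    rw [himage ξ ρ, Finset.sum_image (hinjβ ξ ρ).injOn, Finset.sum_div, Finset.mul_sum, Finset.mul_sum]
    refine Finset.sum_congr rfl fun β _ => ?_
    have h2 : (2 : ℝ) ^ (k + 1) * (1 / 2) ^ (k + 1) = 1 := by rw [← mul_pow]; norm_num
    calc (2 : ℝ) ^ (k + 1) * ((1 / 2) ^ (k + 1) * (1 / 2 * μIK.real (Rfib ρ)) * g _)
        = (2 ^ (k + 1) * (1 / 2) ^ (k + 1)) * (μIK.real (Rfib ρ) * (g _ / 2)) := by ring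
      _ = _ := by rw [h2, one_mul]

end CondBoxStub

/-- **Registered helper `condBox_eq_noiseOp`** (ROW-1 TILT REPRESENTATION, line `defect-closure-exploration`): the
conditional probability of a box event given the colours of the row below the box is the noise operator (flip
probabilities `2√3 − 3` on `S`-columns, `½` elsewhere) applied to a `[0, 1]`-valued function of the INCREMENTS of
the conditioning row. -/
theorem condBox_eq_noiseOp : ∀ (S : Set ℤ) (a : ℤ) (k h : ℕ) (E : Set Obs), MeasurableSet E →
    E ∈ determinedOn {v : Site 2 | a ≤ v 0 ∧ v 0 < a + k ∧ 1 ≤ v 1 ∧ v 1 ≤ h} →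
    ∃ H : (Fin (k - 1) → Bool) → ℝ, (∀ χ, 0 ≤ H χ ∧ H χ ≤ 1) ∧
      ∀ ξ : Fin k → Bool,
        (2 : ℝ) ^ k * (νmix S).real (E ∩ {x | ∀ i : Fin k, ((![a + i, 0] : Site 2) ∈ x.1 ↔ ξ i = true)}) =
          ∑ ε : Fin (k - 1) → Bool,
            (∏ i : Fin (k - 1), if ε i then (if (a + i : ℤ) ∈ S then 2 * Real.sqrt 3 - 3 else 1 / 2)
                                 else 1 - (if (a + i : ℤ) ∈ S then 2 * Real.sqrt 3 - 3 else 1 / 2)) *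
              H (fun i : Fin (k - 1) => xor (xor (ξ (i.castLE (Nat.sub_le k 1))) (ξ ⟨i + 1, by omega⟩)) (ε i)) := by
  intro S a k h E hEm hE
  obtain _ | k := k
  · haveI := isProbabilityMeasure_nuMix S
    refine ⟨fun _ => (νmix S).real E, fun _ => ⟨measureReal_nonneg, measureReal_le_one⟩, fun ξ => ?_⟩
    have hC : {x : Obs | ∀ i : Fin 0, ((![a + i, 0] : Site 2) ∈ x.1 ↔ ξ i = true)} = Set.univ :=
      Set.eq_univ_of_forall fun x i => i.elim0
    haveI : IsEmpty (Fin (0 - 1)) := Fin.isEmpty'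
    haveI : Unique (Fin (0 - 1) → Bool) := Pi.uniqueOfIsEmpty _
    rw [hC, Set.inter_univ, pow_zero, one_mul, Fintype.sum_unique, Fintype.prod_empty, one_mul]
  · exact CondBoxStub.main S a k h E hEm hE

end Summit.CriticalPhenomena.CardyFormulaZ2.Cruxes.IKMixedBoxCrossing.DefectClosureExploration

end
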